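import Summits.QuantumFields.YangMills.Theorems.BalabanUVNodesN22AtRateRecord13
import Summits.QuantumFields.YangMills.Theorems.BalabanUVNodesN22AtRateRecord13Fixed
import Literature.MathematicalPhysics.QuantumFieldTheory.Balaban1983to89.Node00.RateRecordW1Reading

/-!
# BalabanUVNodes ∕ node N22 AT A W1 RATE READING OF THE STAGE-13 HOME — for ANY Stage-13 reading `𝔯 : RateReading₁₃ N` whose node-U3 objects ARE node00-def-W1's
# `(w1 F θ).u3Objects θ.γ` (`hpin`, ONE pointwise equation — `rfl` for every W1-built reading: `RateReading₁₃.ofAssignment (RateAssignment₁₃.ofStage12 (W1.assignment₁₂ 𝔇)) ne1`,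
# the (T-RATE) reading of record at ₁₃, …): what N22's K4 stub `S_N22 (RRec₁₃ 𝔯)` SAYS (the history-Lipschitz inequality for `Re E(S k)(X; ·; embA U)` per Stage-13
# datum key and run length), ROAD 3 ((O) + (A) on the towers ⟹ the stub), the slot-free road (NE9 in a fading table), and honesty (vanishing towers close the stub)

Track A of `YM-PLAN.md` (cell `pub-ymgap`, HUMAN RULING D-0062), R134 seat `pub-ymgap-dag-n22-e` (s2 «`FadingMemory` by name from a modulus + knit at the record»), gen 5,
module 9″c = the Stage-13 twin of the lineage's module 4 `…N22AtW1Reading12.lean` (p467930), GENERALISED from the one named reading `ofAssignment (W1.assignment₁₂ 𝔇) ne1`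
to every reading with the W1 pin `hpin : ∀ F θ hP g₀ os, (𝔯.lit F θ hP g₀ os).u3 = (w1 F θ).u3Objects θ.γ` (dag-n16-e's `hpin`-generic pattern for the NE3 component,
`…N16AtTupleReading13`; here for node U3's), so that node00-def-W1's future Stage-13 container, RR-2's lift `RateAssignment₁₃.ofStage12`, and the reading of record at ₁₃
all instantiate it with `hpin := fun _ _ _ _ _ => rfl`.  `w1 : (F : T4Family) → (θ : Stage13Params F N) → W1.ReadingData F (M_N ℂ) θ.τ9.M` is W1's STAGE-FREE reading-data
container (`Node00/RateRecordW1Reading` §3, p465810) read per Stage-13 tuple.  THEOREMS ONLY, every proof one application by name of modules 9″a ∕ 9″b and W1's `ReadingData`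
faces (`prefixDependenceOn_u3Objects_EA`, `u3Objects_ω ∕ _C₉`, `ne9_u3Objects_iff`); restate-immune (no Theses import); COUNT-NEUTRAL; `--supports` K3‴ `SpineGivenEndpointR13`
(stmt-QuantumFields-19912) as a helper (director-ym LINE №125 ∕ №133; dag-lead WORDS-133 ∕ 134 ∕ 135).

WHAT IS KERNEL-CHECKED ([folklore]; 0 `def`, 0 `sorry`).
* §1 `s_N22_rRec₁₃_w1_iff` (the stub IS «`N22At` at every Stage-13 datum key and run length of W1's objects at the canonical parameter» — `g₀`, `os`, `ne1 ∕ ne2 ∕ ne3` idle) ·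
  `n22At_u3OfRecord₁₃_w1_iff_ne9` (under the analytic block's signs, `N22At` at the W1 bundle IS the history-Lipschitz inequality for `Re E(S k)`) · `s_N22_rRec₁₃_w1_iff_ne9`.
* §2 ROAD 3: `s_N22_rRec₁₃_w1_of_oscAnalytic` ((O) + (A) on the towers + the inputs' numerals ⟹ the stub; (P) and the letter equations free).
* §3 `s_N22_rRec₁₃_w1_of_ne9_fading` (NE9 of the level functionals in SOME fading table ⟹ the stub).
* §4 `s_N22_rRec₁₃_w1_of_EA_zero` (HONESTY: vanishing towers close the stub — a discharge keyed to a W1 reading NAMES its towers).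

HONEST FRAMING.  Every estimate ((O), (A), NE9, the numerals) is a DISPLAYED hypothesis on W1's residual reading data `w1` with NO producer at a reading of record today; nothing
of Bałaban's is asserted or instantiated — NE9 is NOT PRINTED for d = 4 and NOT PROVED; no inhabitant of `IsDatumOfRecord₁₃C` claimed (K0‴ `Record13Inhabited`,
stmt-QuantumFields-19909, OPEN); N22 NOT discharged; counts UNMOVED (typed 28∕28 · discharged 5∕27, A 5∕28); one finite four-torus programme at fixed `ε` — NOT ℝ⁴, NOT infinite
volume, NOT OS, NOT a mass gap, NOT Clay.  No decl below carries a cite tag.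
-/

noncomputable section

namespace YMDAG.N22

open Set Metric
open scoped BigOperators
open Literature.MathematicalPhysics.QuantumFieldTheory.Balaban1983to89
open Literature.MathematicalPhysics.QuantumFieldTheory.Balaban1983to89.T4Continuum
open Literature.MathematicalPhysics.QuantumFieldTheory.Balaban1983to89.T4OutputRate
open Literature.MathematicalPhysics.QuantumFieldTheory.Balaban1983to89.Node00 (Stage13Params IsDatumOfRecord₁₃C U3Objects₁₁ U3Letters₁₁ MatA)
open Literature.MathematicalPhysics.QuantumFieldTheory.Balaban1983to89.Node00.Sect2 (domSys)
open Literature.MathematicalPhysics.QuantumFieldTheory.Balaban1983to89.Node00.W1 (ReadingData functionalC)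
open YMDAG.UVSplit

variable {N : ℕ} [NeZero N] (𝔯 : RateReading₁₃ N) (w1 : (F : T4Family) → (θ : Stage13Params F N) → ReadingData F (MatA N) θ.τ9.M)

/-! ## §1 What `S_N22 (RRec₁₃ 𝔯)` says at a W1-pinned reading -/

/-- **`S_N22 (RRec₁₃ 𝔯)` AT A W1-PINNED READING IS «`N22At` AT EVERY STAGE-13 DATUM KEY AND RUN LENGTH of W1's objects at the canonical parameter»** (`g₀`, `os` and the
other components idle). [folklore] -/
theorem s_N22_rRec₁₃_w1_iff
    (hpin : ∀ (F : T4Family) (θ : Stage13Params F N) (hP : θ.Provisos₁₃ F N) (g₀ : ℕ → ℝ) (os : List (ULoop F)), (𝔯.lit F θ hP g₀ os).u3 = (w1 F θ).u3Objects θ.γ) :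
    S_N22 (RRec₁₃ 𝔯) ↔
      ∀ (F : T4Family) (D : Datum F N) (h : IsDatumOfRecord₁₃C F N D) (k : ℕ), N22At (u3OfRecord₁₃ h.params ((w1 F h.params).u3Objects h.params.γ) k) := by
  rw [s_N22_rRec₁₃_iff]
  refine ⟨fun H F D h k => ?_, fun H F D h g₀ os k => ?_⟩
  · have := H F D h (fun _ => 0) [] k
    rwa [hpin] at this
  · rw [hpin]
    exact H F D h k

/-- **UNDER THE ANALYTIC BLOCK's SIGNS, `N22At` AT THE STAGE-13 W1 BUNDLE IS THE HISTORY-LIPSCHITZ INEQUALITY FOR `Re E^{(j)}(X; ·; embA U)` OF THE TOWER `(w1 F θ).S k`**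
on the `k`-th torus: for all histories `g, g′ ∈ ]0, θ.γ]^ℕ`, run-A backgrounds `U` and domains `(j, X)`,
`|Re E(S k)(X; g; embA U) − Re E(S k)(X; g′; embA U)| ≤ e^{−κ·d_j(X)} · Σ_{i<j} C₉·ω^{j−i}·|g_i − g′_i|` with `κ = li.κ` and `C₉, ω` the analytic block's at radius `θ.γ`
(layer B's `n22At_u3OfRecord₁₃_iff` + W1's `ne9_u3Objects_iff`, both definitional). [folklore] -/
theorem n22At_u3OfRecord₁₃_w1_iff_ne9 {F : T4Family} (θ : Stage13Params F N) (k : ℕ) (hs : ((w1 F θ).li.analytic θ.γ).Signs) :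
    N22At (u3OfRecord₁₃ θ ((w1 F θ).u3Objects θ.γ) k) ↔
      ∀ g ∈ Window θ.γ, ∀ g' ∈ Window θ.γ, ∀ (U : ((w1 F θ).pairing k).BgA) (X : Node00.W1.Dom (F.P k) θ.τ9.M),
        |(functionalC ((w1 F θ).S k) g (((w1 F θ).pairing k).embA U) X).re - (functionalC ((w1 F θ).S k) g' (((w1 F θ).pairing k).embA U) X).re| ≤
          Real.exp (-(((w1 F θ).li.analytic θ.γ).κ * (domSys (F.P k) θ.τ9.M X.1).dj X.2)) *
            ∑ i ∈ Finset.range X.1, ((w1 F θ).li.analytic θ.γ).moduli X.1 i * |g i - g' i| :=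
  (n22At_u3OfRecord₁₃_iff θ _ k hs).trans ((w1 F θ).ne9_u3Objects_iff θ.γ k (Window θ.γ) _ _)

/-- **WHAT THE STUB SAYS AT A W1-PINNED READING, IN PRINT-LIKE FORM**: under the blocks' signs at every canonical parameter, `S_N22 (RRec₁₃ 𝔯)` IS the history-Lipschitz
inequality above at every Stage-13 datum key and run length. [folklore] -/
theorem s_N22_rRec₁₃_w1_iff_ne9
    (hpin : ∀ (F : T4Family) (θ : Stage13Params F N) (hP : θ.Provisos₁₃ F N) (g₀ : ℕ → ℝ) (os : List (ULoop F)), (𝔯.lit F θ hP g₀ os).u3 = (w1 F θ).u3Objects θ.γ)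
    (hs : ∀ (F : T4Family) (D : Datum F N) (h : IsDatumOfRecord₁₃C F N D), ((w1 F h.params).li.analytic h.params.γ).Signs) :
    S_N22 (RRec₁₃ 𝔯) ↔
      ∀ (F : T4Family) (D : Datum F N) (h : IsDatumOfRecord₁₃C F N D) (k : ℕ),
        ∀ g ∈ Window h.params.γ, ∀ g' ∈ Window h.params.γ,
          ∀ (U : ((w1 F h.params).pairing k).BgA) (X : Node00.W1.Dom (F.P k) h.params.τ9.M),
            |(functionalC ((w1 F h.params).S k) g (((w1 F h.params).pairing k).embA U) X).re -
                (functionalC ((w1 F h.params).S k) g' (((w1 F h.params).pairing k).embA U) X).re| ≤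
              Real.exp (-(((w1 F h.params).li.analytic h.params.γ).κ * (domSys (F.P k) h.params.τ9.M X.1).dj X.2)) *
                ∑ i ∈ Finset.range X.1, ((w1 F h.params).li.analytic h.params.γ).moduli X.1 i * |g i - g' i| := by
  rw [s_N22_rRec₁₃_w1_iff 𝔯 w1 hpin]
  refine forall_congr' fun F => forall_congr' fun D => forall_congr' fun h => forall_congr' fun k => ?_
  exact n22At_u3OfRecord₁₃_w1_iff_ne9 w1 h.params k (hs F D h)

/-! ## §2 ROAD 3 at a W1-pinned reading: (O) + (A) on the towers ⟹ the stub ((P) free, letter equations `rfl`) -/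

/-- **ROAD 3 AT A W1-PINNED STAGE-13 READING.**  If at every admissible Stage-13 tuple with provisos and every run length `k`, W1's level-`k` objects `u := (w1 F θ).u3Objects θ.γ`
carry (O) — oscillation fading `|u.EA k g U X − u.EA k g′ U X| ≤ li.C₀·u.θ₅^{scale X − a}·e^{−κ d X}` for window histories agreeing from `a ≤ scale X` on — and (A) — per young
coupling `i < scale X` a complex-differentiable extension of the section on a set containing the CLOSED `li.r`-discs about `]0, θ.γ]` with sup letter
`li.A·li.μ^{scale X − 1 − i}·e^{−κ d X}` —, and the inputs' numerals `0 < li.C₀`, `0 < li.θ₅`, `0 < li.A`, `li.θ₅ ≤ li.μ`, `li.C₀ ≤ 2·li.A`, `0 < li.r`, `0 < li.s < 1` hold,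
then `S_N22 (RRec₁₃ 𝔯)` — ONE application of module 9″a's `s_N22_rRec₁₃_of_oscAnalytic` with (P) := W1's `prefixDependenceOn_u3Objects_EA` and the letter equations
`u3Objects_ω ∕ u3Objects_C₉` (`rfl`). [folklore] -/
theorem s_N22_rRec₁₃_w1_of_oscAnalytic
    (hpin : ∀ (F : T4Family) (θ : Stage13Params F N) (hP : θ.Provisos₁₃ F N) (g₀ : ℕ → ℝ) (os : List (ULoop F)), (𝔯.lit F θ hP g₀ os).u3 = (w1 F θ).u3Objects θ.γ)
    (hnum : ∀ (F : T4Family) (θ : Stage13Params F N), θ.Provisos₁₃ F N → θ.Admissible F N →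
      0 < (w1 F θ).li.C₀ ∧ 0 < (w1 F θ).li.θ₅ ∧ 0 < (w1 F θ).li.A ∧ (w1 F θ).li.θ₅ ≤ (w1 F θ).li.μ ∧
        (w1 F θ).li.C₀ ≤ 2 * (w1 F θ).li.A ∧ 0 < (w1 F θ).li.r ∧ 0 < (w1 F θ).li.s ∧ (w1 F θ).li.s < 1)
    (hO : ∀ (F : T4Family) (θ : Stage13Params F N), θ.Provisos₁₃ F N → θ.Admissible F N → ∀ (k : ℕ),
      ∀ g ∈ Window θ.γ, ∀ g' ∈ Window θ.γ, ∀ (U : (((w1 F θ).u3Objects θ.γ).levelCarriers k).BgA)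
        (X : (((w1 F θ).u3Objects θ.γ).levelCarriers k).Dom) (a : ℕ), a ≤ (((w1 F θ).u3Objects θ.γ).levelCarriers k).scale X →
        (∀ n, a ≤ n → g n = g' n) →
          |((w1 F θ).u3Objects θ.γ).EA k g U X - ((w1 F θ).u3Objects θ.γ).EA k g' U X| ≤
            (w1 F θ).li.C₀ * ((w1 F θ).u3Objects θ.γ).θ₅ ^ ((((w1 F θ).u3Objects θ.γ).levelCarriers k).scale X - a) *
              Real.exp (-(((w1 F θ).u3Objects θ.γ).κ * (((w1 F θ).u3Objects θ.γ).levelCarriers k).d X)))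
    (hA : ∀ (F : T4Family) (θ : Stage13Params F N), θ.Provisos₁₃ F N → θ.Admissible F N → ∀ (k : ℕ),
      ∀ g ∈ Window θ.γ, ∀ (U : (((w1 F θ).u3Objects θ.γ).levelCarriers k).BgA) (X : (((w1 F θ).u3Objects θ.γ).levelCarriers k).Dom) (i : ℕ),
        i < (((w1 F θ).u3Objects θ.γ).levelCarriers k).scale X → ∃ (Fz : ℂ → ℂ) (Dset : Set ℂ), DifferentiableOn ℂ Fz Dset ∧
          (∀ z ∈ Dset, ‖Fz z‖ ≤ (w1 F θ).li.A * (w1 F θ).li.μ ^ ((((w1 F θ).u3Objects θ.γ).levelCarriers k).scale X - 1 - i) *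
            Real.exp (-(((w1 F θ).u3Objects θ.γ).κ * (((w1 F θ).u3Objects θ.γ).levelCarriers k).d X))) ∧
          (∀ t ∈ Ioc (0 : ℝ) θ.γ, closedBall (t : ℂ) (w1 F θ).li.r ⊆ Dset) ∧
          (∀ t ∈ Ioc (0 : ℝ) θ.γ, Fz t = (((w1 F θ).u3Objects θ.γ).EA k (Function.update g i t) U X : ℂ))) :
    S_N22 (RRec₁₃ 𝔯) := by
  refine s_N22_rRec₁₃_of_oscAnalytic _ fun F θ hP hθ g₀ os k => ?_
  obtain ⟨hC₀, hθ₅, hA0, hθμ, hCA, hr, hs0, hs1⟩ := hnum F θ hP hθ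
  rw [hpin F θ hP g₀ os]
  exact ⟨(w1 F θ).li.C₀, (w1 F θ).li.A, (w1 F θ).li.μ, (w1 F θ).li.r, (w1 F θ).li.s,
    (w1 F θ).prefixDependenceOn_u3Objects_EA θ.γ k (Window θ.γ), hO F θ hP hθ k, hA F θ hP hθ k, hC₀, hθ₅, hA0, hθμ, hCA, hr, hs0, hs1,
    (w1 F θ).u3Objects_ω θ.γ, (w1 F θ).u3Objects_C₉ θ.γ⟩

/-! ## §3 The slot-free road at a W1-pinned reading: NE9 of the level functionals in any fading table -/

/-- **`S_N22 (RRec₁₃ 𝔯)` FROM NE9 IN A FADING TABLE** («`FadingMemory` by name from a modulus» at a W1-pinned Stage-13 reading): at every admissible Stage-13 tuple with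
provisos and run length `k`, the analytic block's signs and NE9 of the level functional `((w1 F θ).u3Objects θ.γ).EA k` on `]0, θ.γ]` with decay `li.κ` in SOME table `Λ` fading
— `FadingMemory C₉ ω Λ` with `ω` the block's rate and `C₉ ≤` the block's amplitude — give the stub (module 9″b's `s_N22_rRec₁₃_of_ne9_fading`). [folklore] -/
theorem s_N22_rRec₁₃_w1_of_ne9_fading
    (hpin : ∀ (F : T4Family) (θ : Stage13Params F N) (hP : θ.Provisos₁₃ F N) (g₀ : ℕ → ℝ) (os : List (ULoop F)), (𝔯.lit F θ hP g₀ os).u3 = (w1 F θ).u3Objects θ.γ)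
    (h9 : ∀ (F : T4Family) (θ : Stage13Params F N), θ.Provisos₁₃ F N → θ.Admissible F N → ∀ (k : ℕ),
      ((w1 F θ).li.analytic θ.γ).Signs ∧ ∃ (Λ : ℕ → ℕ → ℝ) (C₉ : ℝ),
        NE9 (((w1 F θ).u3Objects θ.γ).EA k) (Window θ.γ) (w1 F θ).li.κ Λ ∧
          FadingMemory C₉ ((w1 F θ).li.analytic θ.γ).ω Λ ∧ C₉ ≤ ((w1 F θ).li.analytic θ.γ).C₉) :
    S_N22 (RRec₁₃ 𝔯) :=
  s_N22_rRec₁₃_of_ne9_fading _ fun F θ hP hθ g₀ os k => by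
    rw [hpin F θ hP g₀ os]
    exact h9 F θ hP hθ k

/-! ## §4 Honesty in the kernel: vanishing towers close the stub -/

/-- **INHABITATION IS NOT CONTENT, AT NODE N22's STUB**: if every level functional of the W1 reading data VANISHES identically (as for W1's termless towers) and the analytic
blocks carry their signs at the admissible tuples, then `S_N22 (RRec₁₃ 𝔯)` holds for every W1-pinned reading with NO estimate (NE9 of the zero functional in the block's own
moduli, nonnegative under the signs).  A discharge keyed to a W1 reading therefore NAMES its towers and owes their identification with the construction's (2.14) terms. [folklore] -/
theorem s_N22_rRec₁₃_w1_of_EA_zero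
    (hpin : ∀ (F : T4Family) (θ : Stage13Params F N) (hP : θ.Provisos₁₃ F N) (g₀ : ℕ → ℝ) (os : List (ULoop F)), (𝔯.lit F θ hP g₀ os).u3 = (w1 F θ).u3Objects θ.γ)
    (hs : ∀ (F : T4Family) (θ : Stage13Params F N), θ.Provisos₁₃ F N → θ.Admissible F N → ((w1 F θ).li.analytic θ.γ).Signs)
    (h0 : ∀ (F : T4Family) (θ : Stage13Params F N), θ.Provisos₁₃ F N → θ.Admissible F N → ∀ (k : ℕ) (g : ℕ → ℝ)
      (U : (((w1 F θ).u3Objects θ.γ).levelCarriers k).BgA) (X : (((w1 F θ).u3Objects θ.γ).levelCarriers k).Dom), ((w1 F θ).u3Objects θ.γ).EA k g U X = 0) :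
    S_N22 (RRec₁₃ 𝔯) := by
  refine s_N22_rRec₁₃_of_forall_admissible _ fun F θ hP hθ g₀ os k => ?_
  rw [hpin F θ hP g₀ os]
  refine n22At_u3OfRecord₁₃_of_ne9_le θ _ k (hs F θ hP hθ) (Λ := fun n i => ((w1 F θ).u3Objects θ.γ).C₉ * ((w1 F θ).u3Objects θ.γ).ω ^ (n - i))
    ?_ fun n i _ => le_rfl
  intro g _ g' _ U X
  rw [h0 F θ hP hθ k g U X, h0 F θ hP hθ k g' U X, sub_zero, abs_zero]
  exact mul_nonneg (Real.exp_nonneg _) (Finset.sum_nonneg fun i _ =>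
    mul_nonneg (mul_nonneg (hs F θ hP hθ).C₉_nonneg (pow_nonneg (hs F θ hP hθ).ω_nonneg _)) (abs_nonneg _))

end YMDAG.N22

end
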